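/-
Copyright (c) 2026 the pub-hodgecm-mathlib formalisation cell (harness21).  R90-TF SLAB, section S10 (Rogawski 1990, §13.6–13.8 read at `v`),
prover R90-C138-p08 (g0) — (M-d) of p06 (g0)'s split census (`CENSUS-D14-PSLocalCharTransferSplit.md` T5), DEAL #19-b alternative (R90-C138-plan (g3) 01:11:38Z (4));
h413 = `stmt-HodgeConjecture-24833`, route `HCCMUnconditional`.
-/
import Literature.NumberTheory.Automorphic.UnitaryGroupConstantTermSplit      -- ★ `UnitaryGroup.cmSplitMaxCompact` (`K′ = e′⁻¹ GL₃(𝒪_w)`), `mem_cmSplitMaxCompact_iff`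
import Literature.NumberTheory.Automorphic.LocalUnitaryIntegralLevel          -- ★ `cmLocalIntegralLevel`, `localPiEquiv_symm_mem_localInt_iff`, `unit_placeForm_antidiagOne_mem_glInt`
import HarnessLib

/-!
# R90-TF ∕ S10 — (M-d) AT A SPLIT PLACE THE TWO COMPACT OPEN LEVELS COINCIDE: `K′ = e′⁻¹ GL_N(𝒪_w) = U(H′)(𝒪_v)` for a form hyperspecial at `w`
# (`Theorems/R90S10SplitMaxCompactEqIntegralLevel.lean`; ns `Summit.HodgeConjecture.HodgeConjecture.R90.S10`; LAW L9: ★ Literature imports only; THEOREMS ONLY — no `def`,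
# no instance, no notation, no `sorry`)

Print: [Rogawski1990] §4.4 p. 44 (the maximal compact `K′` at a split place), §14.2 (iii) p. 233 («at split `v`, `G′_v ≅ GL_N(E_w)`»); [PlatonovRapinchuk1994] §5.1 (integral points
`G_{𝒪_v}`); [Tits1979] §3.8 (hyperspecial points).

## WHAT THIS FILE PROVES
At a place `v` of `L⁺` SPLIT in `L` (`w ∣ v`, `c • w ≠ w`), the split-place machinery of ★ `UnitaryGroupConstantTermSplit` (★ `cmSplitTransfer`, its constant
`νG(K′) ∕ νH(K_M)`) uses the compact open `K′ := cmSplitMaxCompact = e′⁻¹ GL₃(𝒪_w)` (`e′ = localSplitEquiv`, the `w`-projection), whereas S10's datum pins the level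
`K_w := cmLocalIntegralLevel L 3 Φ₃ w = U(Φ₃)(𝒪_v)` (C2 `S10Frozen.hKstd`) and the volume `νQw (K_w) = 1` (letter (3) ★ `PSLocalCharTransferLetter`'s `hKG`, `hvol`).  p06 (g0)'s
split reduction needs the two to be THE SAME SUBGROUP (his census T5 ∕ (M-d)): then `νG(K′) = νQw(K_w) = 1` and the constant is print's.  This is ★-adjacent
([PlatonovRapinchuk1994 §5.1] in the tree: ★ `localPiSplitEquiv_symm_mem_localInt_iff` — «`U(J)(𝒪_v) = GL_N(𝒪_w)` at a split place of good reduction», hypothesis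
`J_w ∈ GL_N(𝒪_w)`), and we read it back:
* `localIntegralLevel_eq_comap_localSplitEquiv_glInt` — generic frame `(F, E, c, N, J)`: for `J_w ∈ GL_N(𝒪_w)`, `localIntegralLevel c N J v = (glInt N E_w).comap (localSplitEquiv …)`;
* `cmSplitMaxCompact_eq_cmLocalIntegralLevel` — **(M-d)**: for a HERMITIAN `H′` with `det H′` a unit whose place form is in `GL₃(𝒪_w)`,
  `cmSplitMaxCompact L v w hw H′ hH′ hH′d = cmLocalIntegralLevel L 3 H′ v`;
* `cmSplitMaxCompact_qsForm_eq_cmLocalIntegralLevel` — the QUASI-SPLIT instance `H′ = Φ₃` (hyperspecial everywhere, ★ `unit_placeForm_antidiagOne_mem_glInt`):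
  `cmSplitMaxCompact L v w hw Φ₃ _ _ = cmLocalIntegralLevel L 3 Φ₃ v` — so `νG(K′) = νQw(K_w)` by `rw`.
HONEST LABEL: read-back of ★ [PlatonovRapinchuk1994 §5.1] bookkeeping; pays no socket; HC_CM is proved only modulo the 7 printed citations (2 remaining named inputs: hLiu418 =
`stmt-HodgeConjecture-24832`, h413 = `stmt-HodgeConjecture-24833`) until rung 0 closes; REL ≠ ★ ≠ BUILT.
-/

set_option autoImplicit false
set_option linter.dupNamespace false

noncomputable section

open scoped Matrix MatrixGroups
open NumberField IsDedekindDomain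
open Literature.NumberTheory.Automorphic Literature.NumberTheory.Automorphic.UnitaryGroup

namespace Summit.HodgeConjecture.HodgeConjecture.R90.S10

section Generic

variable {F E : Type} [Field F] [NumberField F] [Field E] [NumberField E] [Algebra F E] [Algebra.IsQuadraticExtension F E]
  (c : E ≃ₐ[F] E) (N : ℕ) (J : Matrix (Fin N) (Fin N) E) {v : HeightOneSpectrum (𝓞 F)}

/-- **`U(J)(𝒪_v) = e′⁻¹ GL_N(𝒪_w)` at a split place of good reduction** (generic frame): for `c ≠ 1`, `J` `c`-hermitian, `w ∣ v` with `c • w ≠ w` and `J_w ∈ GL_N(𝒪_w)`,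
the local integral level ★ `localIntegralLevel c N J v` (the stabiliser of the standard lattice, all `w′ ∣ v`) IS the pull-back of `GL_N(𝒪_w)` along `e′ = localSplitEquiv`
(the `w`-projection): membership at the OTHER place `c w` is automatic because the `c w`-component of `u ∈ U(J)` is `c_*((J u_w J⁻¹)⁻¹)ᵀ`, integral when `u_w` and `J_w^{±1}`
are (★ `localPiSplitEquiv_symm_mem_localInt_iff`). [cite: PlatonovRapinchuk1994, §5.1] [cite: Rogawski1990, §14.2 p. 233] -/
theorem localIntegralLevel_eq_comap_localSplitEquiv_glInt (hc : c ≠ 1) (hJ : (J.map c)ᵀ = J) (w : PlacesOver E v) (hw : c • w.1 ≠ w.1)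
    (hJw : IsUnit (placeForm J w.1)) (hJi : hJw.unit ∈ glInt N (w.1.adicCompletion E)) :
    localIntegralLevel c N J v = (glInt N (w.1.adicCompletion E)).comap (localSplitEquiv c J hc hJ w hw hJw).toMonoidHom := by
  ext g
  rw [Subgroup.mem_comap, ← localPiEquiv_symm_mem_localInt_iff]
  change _ ↔ localPiSplitEquiv c J hc hJ w hw hJw ((localPiEquiv E c N J v).symm g) ∈ glInt N (w.1.adicCompletion E)
  constructor
  · intro h
    exact localPiSplitEquiv_mem_glInt c J hc hJ w hw hJw h
  · intro h
    have h' := (localPiSplitEquiv_symm_mem_localInt_iff c J hc hJ w hw hJw hJi (localPiSplitEquiv c J hc hJ w hw hJw ((localPiEquiv E c N J v).symm g))).2 h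
    rwa [ContinuousMulEquiv.symm_apply_apply] at h'

end Generic

section CM

variable (L : Type) [Field L] [NumberField L] [IsCMField L]
  (v : HeightOneSpectrum (𝓞 ↥(maximalRealSubfield L))) (w : PlacesOver L v) (hw : IsCMField.complexConj L • w.1 ≠ w.1)

/-- **(M-d) `K′ = U(H′)(𝒪_v)` at a split place**: for a hermitian `H′ ∈ M₃(L)` with `det H′` a unit whose place form at `w` lies in `GL₃(𝒪_w)`,
★ `cmSplitMaxCompact L v w hw H′ hH′ hH′d` (`= e′⁻¹ GL₃(𝒪_w)`, the `G′`-side maximal compact of ★ `cmSplitTransfer`'s normalisation) EQUALS ★ `cmLocalIntegralLevel L 3 H′ v`.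
[cite: PlatonovRapinchuk1994, §5.1] [cite: Rogawski1990, §4.4 p. 44; §14.2 p. 233] -/
theorem cmSplitMaxCompact_eq_cmLocalIntegralLevel (H' : Matrix (Fin 3) (Fin 3) L) (hH' : (H'.map (cmConjRingHom L))ᵀ = H') (hH'd : IsUnit H'.det)
    (hH'i : (isUnit_placeForm_of_isUnit_det hH'd w.1).unit ∈ glInt 3 (w.1.adicCompletion L)) :
    cmSplitMaxCompact L v w hw H' hH' hH'd = cmLocalIntegralLevel L 3 H' v :=
  (localIntegralLevel_eq_comap_localSplitEquiv_glInt (IsCMField.complexConj L) 3 H' (IsCMField.complexConj_ne_one L)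
    ((map_cmConjRingHom_eq_map_complexConj L H') ▸ hH') w hw (isUnit_placeForm_of_isUnit_det hH'd w.1) hH'i).symm

/-- **(M-d) FOR THE QUASI-SPLIT FORM `Φ₃`** (hyperspecial at every place, ★ `unit_placeForm_antidiagOne_mem_glInt`): at a split place,
`cmSplitMaxCompact L v w hw Φ₃ hΦ hΦd = cmLocalIntegralLevel L 3 Φ₃ v` for ANY proofs `hΦ`, `hΦd` of hermitian-ness ∕ unit determinant — so the constant `νG(K′)` of ★
`cmSplitTransfer` at `Φ₃` is the datum's `νQw (cmLocalIntegralLevel L 3 Φ₃ v)` by `rw`. [cite: Tits1979, §3.8] [cite: PlatonovRapinchuk1994, §5.1] [cite: Rogawski1990, §4.4 p. 44] -/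
theorem cmSplitMaxCompact_qsForm_eq_cmLocalIntegralLevel
    (hΦ : ((Matrix.of fun i j : Fin 3 => if i.val + j.val + 1 = 3 then (1 : L) else 0).map (cmConjRingHom L))ᵀ =
      Matrix.of fun i j : Fin 3 => if i.val + j.val + 1 = 3 then (1 : L) else 0)
    (hΦd : IsUnit (Matrix.of fun i j : Fin 3 => if i.val + j.val + 1 = 3 then (1 : L) else 0).det) :
    cmSplitMaxCompact L v w hw (Matrix.of fun i j : Fin 3 => if i.val + j.val + 1 = 3 then (1 : L) else 0) hΦ hΦd =
      cmLocalIntegralLevel L 3 (Matrix.of fun i j : Fin 3 => if i.val + j.val + 1 = 3 then (1 : L) else 0) v := by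
  -- the two `IsUnit (placeForm Φ₃ w)` proofs agree (proof irrelevance), so ★ `unit_placeForm_antidiagOne_mem_glInt` applies verbatim
  exact cmSplitMaxCompact_eq_cmLocalIntegralLevel L v w hw _ hΦ hΦd (unit_placeForm_antidiagOne_mem_glInt (E := L) 3 w.1)

end CM

end Summit.HodgeConjecture.HodgeConjecture.R90.S10

end
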